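import Summits.CriticalPhenomena.CardyFormulaZ2.Theorems.CardyIKTransportIKMixedBoxCrossingTransportStubLinkTraceIneqCone
import Summits.CriticalPhenomena.CardyFormulaZ2.Theorems.CardyIKTransportIKMixedBoxCrossingTransportStubLinkTelescope

/-!
# Stub `stub_linkTraceIneq` (H4, THE TRACE INEQUALITY) of the link decomposition (line `defect-closure-exploration`,
# reshape v5b, crux `IKMixedBoxCrossing`, stmt-CriticalPhenomena-5911)

Support file (`--supports stmt-CriticalPhenomena-5911`): `LinkTraceIneq`, i.e. for every necklace `N`, converted set `T`,
crossing pattern `x` and gap `i ∉ T`,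
`piG (gapLen i) · (W T x[i ↦ 1] + W T x[i ↦ 0]) ≤ W T x[i ↦ 1]`.
This file also contains the admissible set `Adm = InC ∪ {1, Fmat 1 - M1}` (closed under products) and THE CONE INEQUALITY
`coneIneq : piG g · tr(Fmat g · A) ≤ tr(M1 · A)` for admissible `A`, `g ≥ 1` (registered helper; constant `432/427` at `g = 1`).

PROOF (lead c5 memo §9.2–9.3).  By the landed additivity `LinkTelescopeStub.W_insert`, `W T x[i↦1] + W T x[i↦0] = W (insert i T) x`,
the trace of the cyclic block product whose `i`-th block is `S^(r_i - 1) · Fmat g_i`, while `W T x[i ↦ 1]` has `i`-th block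
`S^(r_i - 1) · M1` and the same other blocks.  By cyclicity of the trace both are of the form `tr(K · Z)` (`K = Fmat g_i` resp.
`M1`) with the SAME `Z` = (blocks after `i`) · (blocks before `i`) · `S^(r_i - 1)`, a product of ADMISSIBLE matrices
(`LinkTraceIneqAux.Adm`: the cone, the identity, the exceptional generator `Fmat 1 - M1`; every block is admissible and the
admissible set is closed under products).  The cone inequality `LinkTraceIneqAux.coneIneq` gives `piG g · tr(Fmat g · Z) ≤ tr(M1 · Z)`.
The bookkeeping is an induction on the block list with a running admissible prefix.
-/

noncomputable section

namespace Summit.CriticalPhenomena.CardyFormulaZ2.Cruxes.IKMixedBoxCrossing.DefectClosureExploration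

open scoped BigOperators Classical
open Finset Matrix Function
open LinkTraceIneqAux

namespace LinkTraceIneqAux

/-! ### The admissible set and the cone inequality (memo §9.3, Lemmas C–D and the two direct cases) -/

/-- ADMISSIBLE matrices: the cone, the identity, and the exceptional generator. -/
def Adm (ν : Matrix (Fin 2) (Fin 2) ℝ) : Prop := InC ν ∨ ν = 1 ∨ ν = Fmat 1 - M1

/-- The admissible set is closed under multiplication. -/
theorem Adm.mul {ν μ : Matrix (Fin 2) (Fin 2) ℝ} (hν : Adm ν) (hμ : Adm μ) : Adm (ν * μ) := by
  rcases hν with hν | rfl | rfl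
  · rcases hμ with hμ | rfl | rfl
    · exact Or.inl (hν.mul hμ)
    · rw [mul_one]; exact Or.inl hν
    · exact Or.inl hν.mul_M0one
  · rw [one_mul]; exact hμ
  · rcases hμ with hμ | rfl | rfl
    · exact Or.inl (InC.M0one_mul hμ)
    · rw [mul_one]; exact Or.inr (Or.inr rfl)
    · exact Or.inl InC.M0one_sq

/-- Powers of `Smat` are admissible. -/
theorem Adm.smat_pow (n : ℕ) : Adm (Smat ^ n) := by
  induction n with
  | zero => rw [pow_zero]; exact Or.inr (Or.inl rfl)
  | succ n ih => rw [pow_succ]; exact ih.mul (Or.inl InC.smat)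

/-- `Fmat g` is admissible. -/
theorem Adm.fmat (g : ℕ) : Adm (Fmat g) := Adm.smat_pow (g + 1)

/-- `Gmat g b` is admissible for `g ≥ 1`. -/
theorem Adm.gmat (g : ℕ) (hg : 1 ≤ g) (b : Bool) : Adm (Gmat g b) := by
  cases b
  · simp only [Gmat, Bool.false_eq_true, ↓reduceIte]
    rcases Nat.lt_or_ge g 2 with hlt | hge
    · have : g = 1 := by omega
      subst this
      exact Or.inr (Or.inr rfl)
    · exact Or.inl (InC.m0 g hge)
  · simp only [Gmat, ↓reduceIte]
    exact Or.inl InC.m1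

/-! ## §4 The cone inequality -/

/-- `trace (K * A)` for `2 × 2` matrices, written out. -/
theorem trace_mul_two (K A : Matrix (Fin 2) (Fin 2) ℝ) :
    (K * A).trace = K 0 0 * A 0 0 + K 0 1 * A 1 0 + K 1 0 * A 0 1 + K 1 1 * A 1 1 := by
  simp only [Matrix.trace, Matrix.diag, Matrix.mul_apply, Fin.sum_univ_two]
  ring

/-- `piG g * 2^(g+1) = 1`. -/
theorem piG_mul_pow (g : ℕ) : piG g * 2 ^ (g + 1) = 1 := by
  unfold piG; rw [← mul_pow]; norm_num

/-- `0 < piG g`. -/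
theorem piG_pos (g : ℕ) : 0 < piG g := by unfold piG; positivity

/-- LEMMA D (the constant): `A_n (r_*² + 1) + 2 r_* B_n ≤ (36/25) 2^n` for `n ≥ 2` — at `n = 2` this is `427/75 ≤ 432/75`, and
the left side grows by a factor `≤ 1 + t < 2` per step. -/
theorem lemmaD (n : ℕ) (hn : 2 ≤ n) : A n * (rS * rS + 1) + 2 * rS * B n ≤ 36 / 25 * 2 ^ n := by
  induction n with
  | zero => omega
  | succ n ih =>
    rcases Nat.lt_or_ge n 2 with hlt | hge
    · have : n = 1 := by omega
      subst this
      rw [A_two, B_two, rS_eq]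
      nlinarith [s3_facts.1, s3_gt, s3_lt]
    · have ih' := ih hge
      have hBA := (AB_bounds n).2
      rw [A_succ, B_succ, pow_succ]
      have hr0 : 0 < rS := by rw [rS_eq]; linarith [s3_gt]
      have hs' := s3_lt
      -- L_{n+1} = (1+t) L_n + t (r_* - 1)^2 (B_n - A_n) ≤ (1+t) L_n ≤ 2 L_n ≤ 2 R_n
      have hid : (A n + s3 / 2 * B n) * (rS * rS + 1) + 2 * rS * (s3 / 2 * A n + B n) =
          (1 + s3 / 2) * (A n * (rS * rS + 1) + 2 * rS * B n) + s3 / 2 * (rS - 1) ^ 2 * (B n - A n) := by ring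
      have hneg : s3 / 2 * (rS - 1) ^ 2 * (B n - A n) ≤ 0 :=
        mul_nonpos_of_nonneg_of_nonpos (by positivity) (by linarith [hBA.2])
      have hL0 : 0 ≤ A n * (rS * rS + 1) + 2 * rS * B n := by
        have := (AB_bounds n).1.le; have := hBA.1; positivity
      rw [hid]
      nlinarith

/-- THE CONE INEQUALITY on the cone: `piG g * trace (Fmat g * ν) ≤ trace (M1 * ν)` for `ν ∈ InC`, `g ≥ 1`. -/
theorem coneIneq_InC {ν : Matrix (Fin 2) (Fin 2) ℝ} (hν : InC ν) (g : ℕ) (hg : 1 ≤ g) :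
    piG g * (Fmat g * ν).trace ≤ (M1 * ν).trace := by
  obtain ⟨hν0, hνc, hνr⟩ := hν
  obtain ⟨f00, f01, f10, f11⟩ := Fmat_apply g
  obtain ⟨m00, m01, m10, m11⟩ := M1_apply
  rw [trace_mul_two, trace_mul_two, f00, f01, f10, f11, m00, m01, m10, m11]
  have hw : 0 ≤ ν 1 1 := hν0 1 1
  have hxy : rS * ν 1 0 ≤ ν 0 0 := (hνc 0).1
  have hyw : rS * ν 1 1 ≤ ν 1 0 := (hνr 1).1
  have hzw : rS * ν 1 1 ≤ ν 0 1 := (hνc 1).1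
  have hcA := four_A_le (g + 1) (by omega)
  have hcB := four_B_le (g + 1) (by omega)
  have hD := lemmaD (g + 1) (by omega)
  have hr0 : 0 < rS := by rw [rS_eq]; linarith [s3_gt]
  have hpi := piG_pos g
  have hxw : rS * rS * ν 1 1 ≤ ν 0 0 := by nlinarith
  have hyzw : 2 * rS * ν 1 1 ≤ ν 1 0 + ν 0 1 := by nlinarith
  -- everything multiplied by 2^(g+1); `piG g * 2^(g+1) = 1`
  have key : A (g + 1) * ν 0 0 + B (g + 1) * ν 1 0 + B (g + 1) * ν 0 1 + A (g + 1) * ν 1 1 ≤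
      2 ^ (g + 1) * (3 / 4 * ν 0 0 + s3 / 4 * ν 1 0 + s3 / 4 * ν 0 1 + 1 / 4 * ν 1 1) := by
    have hid : 2 ^ (g + 1) * (3 / 4 * ν 0 0 + s3 / 4 * ν 1 0 + s3 / 4 * ν 0 1 + 1 / 4 * ν 1 1) -
        (A (g + 1) * ν 0 0 + B (g + 1) * ν 1 0 + B (g + 1) * ν 0 1 + A (g + 1) * ν 1 1) =
        (3 * 2 ^ (g + 1) - 4 * A (g + 1)) / 4 * (ν 0 0 - rS * rS * ν 1 1) +
        (s3 * 2 ^ (g + 1) - 4 * B (g + 1)) / 4 * (ν 1 0 + ν 0 1 - 2 * rS * ν 1 1) +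
        ν 1 1 * (2 ^ (g + 1) * (3 / 4 * (rS * rS) + s3 / 2 * rS + 1 / 4) -
          (A (g + 1) * (rS * rS + 1) + 2 * rS * B (g + 1))) := by ring
    have h1 : 0 ≤ (3 * 2 ^ (g + 1) - 4 * A (g + 1)) / 4 * (ν 0 0 - rS * rS * ν 1 1) :=
      mul_nonneg (by linarith) (by linarith)
    have h2 : 0 ≤ (s3 * 2 ^ (g + 1) - 4 * B (g + 1)) / 4 * (ν 1 0 + ν 0 1 - 2 * rS * ν 1 1) :=
      mul_nonneg (by linarith) (by linarith)
    have h3 : 0 ≤ ν 1 1 * (2 ^ (g + 1) * (3 / 4 * (rS * rS) + s3 / 2 * rS + 1 / 4) -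
        (A (g + 1) * (rS * rS + 1) + 2 * rS * B (g + 1))) := by
      rw [nuStar_val]
      exact mul_nonneg hw (by linarith)
    linarith
  calc piG g * (A (g + 1) * ν 0 0 + B (g + 1) * ν 1 0 + B (g + 1) * ν 0 1 + A (g + 1) * ν 1 1)
      ≤ piG g * (2 ^ (g + 1) * (3 / 4 * ν 0 0 + s3 / 4 * ν 1 0 + s3 / 4 * ν 0 1 + 1 / 4 * ν 1 1)) :=
        mul_le_mul_of_nonneg_left key hpi.le
    _ = 3 / 4 * ν 0 0 + s3 / 4 * ν 1 0 + s3 / 4 * ν 0 1 + 1 / 4 * ν 1 1 := by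
        rw [← mul_assoc, piG_mul_pow, one_mul]

/-- Direct case `ν = 1`: `piG g · tr(Fmat g) ≤ tr(M1) = 1`, i.e. `2 A_{g+1} ≤ 2^{g+1}`. -/
theorem coneIneq_one (g : ℕ) : piG g * (Fmat g * (1 : Matrix (Fin 2) (Fin 2) ℝ)).trace ≤ (M1 * 1).trace := by
  obtain ⟨f00, -, -, f11⟩ := Fmat_apply g
  obtain ⟨m00, m01, m10, m11⟩ := M1_apply
  rw [mul_one, mul_one]
  simp only [Matrix.trace, Matrix.diag, Fin.sum_univ_two, f00, f11, m00, m11]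
  have hk := two_A_le (g + 1) (by omega)
  calc piG g * (A (g + 1) + A (g + 1)) ≤ piG g * 2 ^ (g + 1) := by
        apply mul_le_mul_of_nonneg_left (by linarith) (piG_pos g).le
    _ = 3 / 4 + 1 / 4 := by rw [piG_mul_pow]; norm_num

/-- Direct case `ν = Fmat 1 - M1`: `tr(M1 · M0₁) = 9/4` and `piG g · tr(Fmat g · M0₁) ≤ 9/4`
(`(5/2) A_n + (3√3/2) B_n ≤ (9/4) 2^n` for `n ≥ 2`). -/
theorem coneIneq_M0one (g : ℕ) (hg : 1 ≤ g) :
    piG g * (Fmat g * (Fmat 1 - M1)).trace ≤ (M1 * (Fmat 1 - M1)).trace := by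
  obtain ⟨f00, f01, f10, f11⟩ := Fmat_apply g
  obtain ⟨m00, m01, m10, m11⟩ := M1_apply
  obtain ⟨e00, e01, e10, e11⟩ := M0one_apply
  rw [trace_mul_two, trace_mul_two, f00, f01, f10, f11, m00, m01, m10, m11, e00, e01, e10, e11]
  have hg2 : 2 ≤ g + 1 := by omega
  have key : ∀ m, 2 ≤ m → (5 / 2) * A m + (3 * s3 / 2) * B m ≤ 9 / 4 * 2 ^ m := by
    intro m hm
    induction m with
    | zero => omega
    | succ m ih =>
      rcases Nat.lt_or_ge m 2 with hlt | hge
      · have : m = 1 := by omega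
        subst this
        rw [A_two, B_two]
        nlinarith [s3_facts.1, s3_gt, s3_lt]
      · have := ih hge
        have hBA := (AB_bounds m).2
        have htB := tA_le_B m (by omega)
        rw [A_succ, B_succ, pow_succ]
        nlinarith [s3_facts.1, s3_gt, s3_lt, hBA.1, hBA.2, (AB_bounds m).1.le]
  have hk := key (g + 1) hg2
  have hs := s3_facts.1
  calc piG g * (A (g + 1) * 1 + B (g + 1) * (3 * s3 / 4) + B (g + 1) * (3 * s3 / 4) + A (g + 1) * (3 / 2))
      = piG g * ((5 / 2) * A (g + 1) + (3 * s3 / 2) * B (g + 1)) := by ring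
    _ ≤ piG g * (9 / 4 * 2 ^ (g + 1)) := mul_le_mul_of_nonneg_left hk (piG_pos g).le
    _ = 3 / 4 * 1 + s3 / 4 * (3 * s3 / 4) + s3 / 4 * (3 * s3 / 4) + 1 / 4 * (3 / 2) := by
        rw [mul_left_comm, piG_mul_pow, mul_one]; nlinarith [hs]

/-- **THE CONE INEQUALITY**: for every admissible `ν` and every gap length `g`,
`piG g * trace (Fmat g * ν) ≤ trace (M1 * ν)`. -/
theorem coneIneq : ∀ {ν : Matrix (Fin 2) (Fin 2) ℝ}, Adm ν → ∀ (g : ℕ), 1 ≤ g →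
    piG g * (Fmat g * ν).trace ≤ (M1 * ν).trace := by
  intro ν hν g hg
  rcases hν with h | rfl | rfl
  · exact coneIneq_InC h g hg
  · exact coneIneq_one g
  · exact coneIneq_M0one g hg

end LinkTraceIneqAux

namespace LinkTraceIneqStub

/-- The ordered product of a list of admissible matrices is admissible. -/
theorem adm_prod_ofFn : ∀ {k : ℕ} (F : Fin k → Matrix (Fin 2) (Fin 2) ℝ), (∀ j, Adm (F j)) → Adm (List.ofFn F).prod
  | 0, F, _ => by rw [List.ofFn_zero, List.prod_nil]; exact Or.inr (Or.inl rfl)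
  | k + 1, F, hF => by
      rw [List.ofFn_succ, List.prod_cons]
      exact (hF 0).mul (adm_prod_ofFn (fun j => F j.succ) fun j => hF _)

/-- THE COMPARISON ALONG A BLOCK LIST: if `F` and `F₁` agree off position `i`, all their entries off `i` are admissible,
`F i = R * Fmat g` and `F₁ i = R * M1` with `R` admissible and `g ≥ 1`, then for all admissible `X`, `Y`,
`piG g · tr(X · ∏ F · Y) ≤ tr(X · ∏ F₁ · Y)`. -/
theorem trace_compare : ∀ {k : ℕ} (i : Fin k) (F F₁ : Fin k → Matrix (Fin 2) (Fin 2) ℝ)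
    (R : Matrix (Fin 2) (Fin 2) ℝ) (g : ℕ), 1 ≤ g → Adm R → (∀ j, j ≠ i → F₁ j = F j) → (∀ j, j ≠ i → Adm (F j)) →
      F i = R * Fmat g → F₁ i = R * M1 → ∀ X Y : Matrix (Fin 2) (Fin 2) ℝ, Adm X → Adm Y →
        piG g * (X * (List.ofFn F).prod * Y).trace ≤ (X * (List.ofFn F₁).prod * Y).trace
  | 0, i, _, _, _, _, _, _, _, _, _, _, _, _, _, _ => i.elim0
  | k + 1, i, F, F₁, R, g, hg, hR, hagree, hadm, hFi, hF₁i, X, Y, hX, hY => by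
      rw [List.ofFn_succ, List.ofFn_succ, List.prod_cons, List.prod_cons]
      rcases Fin.eq_zero_or_eq_succ i with rfl | ⟨i', rfl⟩
      · -- the distinguished block is the head
        have htail : (fun j : Fin k => F₁ j.succ) = fun j => F j.succ :=
          funext fun j => hagree _ (Fin.succ_ne_zero j)
        rw [htail, hFi, hF₁i]
        set P := (List.ofFn fun j : Fin k => F j.succ).prod with hP
        have hPadm : Adm P := adm_prod_ofFn _ fun j => hadm _ (Fin.succ_ne_zero j)
        have hZ : Adm (P * Y * X * R) := ((hPadm.mul hY).mul hX).mul hR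
        have key := coneIneq hZ g hg
        have e1 : (X * (R * Fmat g * P) * Y).trace = (Fmat g * (P * Y * X * R)).trace := by
          rw [show X * (R * Fmat g * P) * Y = (X * R) * (Fmat g * (P * Y)) by noncomm_ring, Matrix.trace_mul_comm,
            show Fmat g * (P * Y) * (X * R) = Fmat g * (P * Y * X * R) by noncomm_ring]
        have e2 : (X * (R * M1 * P) * Y).trace = (M1 * (P * Y * X * R)).trace := by
          rw [show X * (R * M1 * P) * Y = (X * R) * (M1 * (P * Y)) by noncomm_ring, Matrix.trace_mul_comm,
            show M1 * (P * Y) * (X * R) = M1 * (P * Y * X * R) by noncomm_ring]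
        rw [e1, e2]
        exact key
      · -- the distinguished block is in the tail: absorb the head into `X`
        have h0 : F₁ 0 = F 0 := hagree 0 (Fin.succ_ne_zero i').symm
        rw [h0]
        have hX' : Adm (X * F 0) := hX.mul (hadm 0 (Fin.succ_ne_zero i').symm)
        have ih := trace_compare i' (fun j : Fin k => F j.succ) (fun j => F₁ j.succ) R g hg hR
          (fun j hj => hagree _ fun h => hj (Fin.succ_inj.mp h)) (fun j hj => hadm _ fun h => hj (Fin.succ_inj.mp h))
          hFi hF₁i (X * F 0) Y hX' hY
        rw [show X * (F 0 * (List.ofFn fun j : Fin k => F j.succ).prod) * Y =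
            X * F 0 * (List.ofFn fun j : Fin k => F j.succ).prod * Y by noncomm_ring,
          show X * (F 0 * (List.ofFn fun j : Fin k => F₁ j.succ).prod) * Y =
            X * F 0 * (List.ofFn fun j : Fin k => F₁ j.succ).prod * Y by noncomm_ring]
        exact ih

variable {L : ℕ} (N : Necklace L)

/-- Every hybrid block is admissible. -/
theorem adm_block (T : Finset (Fin N.k)) (x : Fin N.k → Bool) (j : Fin N.k) : Adm (N.block T x j) := by
  unfold Necklace.block
  refine (Adm.smat_pow _).mul ?_
  split_ifs
  · exact Adm.fmat _
  · exact Adm.gmat _ (N.gap_pos j) _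

end LinkTraceIneqStub

open LinkTraceIneqStub in
/-- **STUB · `stub_linkTraceIneq`** (H4): for every necklace, converted set `T`, crossing pattern `x` and gap `i ∉ T`,
`piG (gapLen i) · (W T x[i ↦ true] + W T x[i ↦ false]) ≤ W T x[i ↦ true]`. -/
theorem stub_linkTraceIneq : LinkTraceIneq := by
  intro L N T x i hi _hL
  rw [← LinkTelescopeStub.W_insert N T x hi]
  unfold Necklace.W Necklace.prodMat
  -- blocks of `(insert i T, x)` and of `(T, x[i ↦ true])`
  set F : Fin N.k → Matrix (Fin 2) (Fin 2) ℝ := N.block (insert i T) x with hF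
  set F₁ : Fin N.k → Matrix (Fin 2) (Fin 2) ℝ := N.block T (update x i true) with hF₁
  have hagree : ∀ j, j ≠ i → F₁ j = F j := by
    intro j hj
    simp only [hF, hF₁, Necklace.block, Finset.mem_insert, update_of_ne hj]
    rcases em (j ∈ T) with hjT | hjT
    · simp only [hjT, if_true, or_true]
    · simp only [hjT, if_false, hj, false_or]
  have hFi : F i = Smat ^ (N.runLen i - 1) * Fmat (N.gapLen i) := by
    simp only [hF, Necklace.block, Finset.mem_insert_self, if_true]
  have hF₁i : F₁ i = Smat ^ (N.runLen i - 1) * M1 := by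
    simp only [hF₁, Necklace.block, if_neg hi, update_self, Gmat, if_true]
  have key := trace_compare i F F₁ (Smat ^ (N.runLen i - 1)) (N.gapLen i) (N.gap_pos i) (Adm.smat_pow _) hagree
    (fun j _ => adm_block N (insert i T) x j) hFi hF₁i 1 1 (Or.inr (Or.inl rfl)) (Or.inr (Or.inl rfl))
  simpa only [one_mul, mul_one] using key

end Summit.CriticalPhenomena.CardyFormulaZ2.Cruxes.IKMixedBoxCrossing.DefectClosureExploration

end
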